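import Summits.QuantumFields.QCD.Theses.PauliWegnerSea
import Literature.MathematicalPhysics.QuantumFieldTheory.QCDPhaseQuenched
import Literature.Barriers.QuantumFields.WilsonDeterminantSign

/-!
# `GluonicCompletion` (crux stmt-QuantumFields-9152) — negative-side support: the range of the
# sign-coherence constant of clause (iv) and the independent-block model of sign decoherence

Definition-free extract of the standing disprover's `Disproof.lean` (cdisprove g2, §4/§8/§9):
* `signRatio_le_one`: the sign ratio `‖∫ det D dμ_W‖ / ∫ |det D| dμ_W` of clause (iv) never exceeds `1`, so
  `not_eventually_le_signRatio_of_one_lt`: the clause with any constant `c > 1` in place of `½` is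
  unsatisfiable (and the corresponding crux vacuous); the constants `c ∈ (0, 1]` all carry the same
  mechanism (reweighting then costs `1/c`, cf. `Negative.detRatio_le_two_mul_absMoment`).
* `det_re_nonneg_const_even`: an even number of mass-degenerate flavours has `det D = (det D_W)^{N_f} ≥ 0`
  (barrier evasion `WilsonDeterminantSign.pow_even_nonneg`), where the ratio is `1`
  (`Negative.signRatio_eq_one_of_det_re_nonneg`): (iv) bites only at odd `N_f` or split masses.
* `blocks_signRatio_eq_pow`, `blocks_half_le_pow_all_iff`: if the signed weight factorised over `n`
  independent identically distributed blocks, the `n`-block sign ratio would be the `n`-th power `rⁿ` of the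
  one-block ratio, and `½ ≤ rⁿ` for all `n` forces `r = 1` — the formal shadow of the item's why-might-fail
  (`⟨σ⟩_{|w|} ~ exp(−c (a_k S)^4)` at fixed `k`): sign coherence at the scheme's own side says nothing about
  the larger tori over which `HasLatticeMassGap` quantifies, and asking it on all tori would forbid sign
  defects altogether.
-/

noncomputable section

namespace Summit.QuantumFields.QCD.Theorems.GluonicCompletion.Negative

open MeasureTheory Filter
open scoped Topology
open Literature.MathematicalPhysics.QuantumFieldTheory Literature.MathematicalPhysics.QuantumLattice
  Literature.Probability.LatticeModels

variable {Nf : ℕ} {S : ℕ} [NeZero S]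

/-- The sign ratio never exceeds `1` (`‖∫ det‖ ≤ ∫ ‖det‖`; junk `0` if the denominator vanishes). [folklore] -/
theorem signRatio_le_one (β : ℝ) (mq : Fin Nf → ℝ) :
    ‖∫ U, (diracMatrix U mq).det ∂(wilsonMeasure (d := 4) (L := S) (fundamentalRep (Fin 3)) β)‖ /
        ∫ U, ‖(diracMatrix U mq).det‖ ∂(wilsonMeasure (d := 4) (L := S) (fundamentalRep (Fin 3)) β) ≤ 1 := by
  rcases (integral_nonneg fun U => norm_nonneg ((diracMatrix U mq).det) :
      (0 : ℝ) ≤ ∫ U, ‖(diracMatrix U mq).det‖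
        ∂(wilsonMeasure (d := 4) (L := S) (fundamentalRep (Fin 3)) β)).lt_or_eq with hpos | h0
  · exact (div_le_one hpos).2 (norm_integral_le_integral_norm _)
  · rw [← h0, div_zero]; exact zero_le_one

/-- So a sign-coherence clause with constant `c > 1` (in place of `½`) is unsatisfiable along any sequence of
sides `L_k`, couplings `β_k` and bare masses `m(k)`. [folklore] -/
theorem not_eventually_le_signRatio_of_one_lt {c : ℝ} (hc : 1 < c) (L : ℕ → ℕ) (β : ℕ → ℝ)
    (mb : ℕ → Fin Nf → ℝ) :
    ¬ ∀ᶠ k in atTop, c ≤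
      ‖∫ U, (diracMatrix U (mb k)).det ∂(wilsonMeasure (d := 4) (L := 2 * L k + 1) (fundamentalRep (Fin 3)) (β k))‖ /
        ∫ U, ‖(diracMatrix U (mb k)).det‖ ∂(wilsonMeasure (d := 4) (L := 2 * L k + 1) (fundamentalRep (Fin 3)) (β k)) :=
  fun h => by
    obtain ⟨k, hk⟩ := h.exists
    exact absurd (hk.trans (signRatio_le_one _ _)) (not_le.2 hc)

/-- An EVEN number of mass-degenerate flavours: `det D = (det D_W)^{N_f} ≥ 0` (barrier evasion
`WilsonDeterminantSign.pow_even_nonneg`). [folklore] -/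
theorem det_re_nonneg_const_even (hNf : Even Nf) (U : GaugeConfig 4 S SU3) (m0 : ℝ) :
    0 ≤ ((diracMatrix U fun _ : Fin Nf => m0).det).re := by
  rw [det_diracMatrix, Finset.prod_const, Finset.card_univ, Fintype.card_fin]
  exact Literature.Barriers.QuantumFields.WilsonDeterminantSign.pow_even_nonneg _
    (fun g => fundamentalRep_mem_unitaryGroup g) U m0 1 hNf

/-- **Independent blocks.** If the signed weight factorised over `n` independent, identically distributed
blocks with one-block weight `f` (law `μ`), the `n`-block sign ratio is the `n`-th power of the one-block
ratio (Fubini). [folklore] -/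
theorem blocks_signRatio_eq_pow {X : Type*} [MeasurableSpace X] (μ : Measure X) [SigmaFinite μ]
    (f : X → ℝ) (n : ℕ) :
    (∫ x : Fin n → X, ∏ i, f (x i) ∂(Measure.pi fun _ => μ)) /
        (∫ x : Fin n → X, ∏ i, |f (x i)| ∂(Measure.pi fun _ => μ)) =
      ((∫ x, f x ∂μ) / ∫ x, |f x| ∂μ) ^ n := by
  rw [integral_fintype_prod_eq_pow (ι := Fin n) (μ := μ) f,
    integral_fintype_prod_eq_pow (ι := Fin n) (μ := μ) (fun y => |f y|), Fintype.card_fin, div_pow]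

/-- In the block model a bound `½ ≤ rⁿ` at ALL block numbers `n` forces `r = 1` (no sign defects at all):
`½ ≤ rⁿ ∀ n ↔ r = 1` for `0 ≤ r ≤ 1`. [folklore] -/
theorem blocks_half_le_pow_all_iff {r : ℝ} (h0 : 0 ≤ r) (hr : r ≤ 1) :
    (∀ n : ℕ, (1 / 2 : ℝ) ≤ r ^ n) ↔ r = 1 := by
  constructor
  · intro h
    by_contra hne
    have h1 : r < 1 := lt_of_le_of_ne hr hne
    have hev : ∀ᶠ n : ℕ in atTop, r ^ n < 1 / 2 :=
      (tendsto_pow_atTop_nhds_zero_of_lt_one h0 h1).eventually (gt_mem_nhds (by norm_num))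
    obtain ⟨n, hn⟩ := hev.exists
    exact absurd (h n) (not_le.2 hn)
  · rintro rfl n
    norm_num

end Summit.QuantumFields.QCD.Theorems.GluonicCompletion.Negative

end
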